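import Summits.NavierStokesRegularity.NavierStokesRegularity.Theorems.WakeRatchetEternalViscousRateLeakRatchetVisc

/-!
# Dissipation edge (crux `WakeRatchet.EternalViscousRate`, ⟨stmt-NavierStokesRegularity-25647⟩) —
# consequences of the leak ratchet for EVERY covariant viscosity: geometric tail-envelope decay, NO CONVEYOR, fading peaks

Corollaries of the landed `tail_succ_le_leak_envelope_visc` (…LeakRatchetVisc) for uniformly bounded admissible eternal solutions with ANY
covariant viscosity `ν̂ ≥ 0` of a cancelling table (`ε₀ > 0`), `M` the uniform action bound, `w := e^{−2C_AΛ⁻¹M}`: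
* `tail_le_leak_pow_visc` — `T_{n+j}(σ) ≤ (1 − w)^j·Θ` for all `j, σ` once `T_n ≤ Θ` (any number of modes);
* `tailEnvelope_decay_visc` — (`m = 4`) every tail envelope decays geometrically along the shells: `∃ Θ, ∀ j σ, T_{n+j}(σ) ≤ (1−w)^j Θ`
  (start from the landed `TailEnvelopeFinite`);
* `noConveyor_all_visc` — given final wakes `ω` and final tails `L` (as limits, supplied by hypothesis exactly as in the conveyor-ledger
  vocabulary), `L n = Σ_k ω(n+k)` for every shell: NO CONVEYOR MASS for bounded admissible eternal solutions of every covariant viscosity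
  (the inviscid case is the by-name-closed `stub_noConveyor` of ⟨25646⟩, p817326);
* `peaksFade_all_visc` — (`m = 4`) single-shell peaks fade: `∀ δ > 0 ∃ n ∀ σ, E_n(σ) ≤ δ`.
So on the viscous child too the tail-envelope mechanism of the route is a theorem with the SOLUTION-DEPENDENT fraction `w(W)`; what `stub_inertial`
(and the parent `TailRateRatchet`) add is the UNIFORM RATE `(1+ε₀)^{−a}`, false modulo `ViscousBlockDSSWaves` (tree Negative lemma).
MODEL lattice only (Tao 2016 §4, viscous equation before Thm. 4.2, §6.4); nothing here is a statement about the Navier–Stokes equations, no stub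
or crux is closed by this file, no summit is proved.
[cite: Tao2016AveragedNS, §4 Lemma 4.1 (4.8)–(4.10) with the cancellation (4.3) and the viscous equation before Thm. 4.2, §6.4]
-/

noncomputable section

set_option linter.dupNamespace false

open Filter Topology Set MeasureTheory
open Literature.Analysis.FluidPDE Literature.Analysis.FluidPDE.TaoCascade
open Summit.NavierStokesRegularity.NavierStokesRegularity.Theorems
open Summit.NavierStokesRegularity.NavierStokesRegularity.Cruxes.EternalInviscidRate.FinalWakeLedger

namespace Summit.NavierStokesRegularity.NavierStokesRegularity.Cruxes.EternalViscousRate.DissipationEdge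

variable {m : ℕ} {ε₀ νh : ℝ} {α : Fin m → Fin m → Fin m → ℤ × ℤ × ℤ → ℝ} {W : ℤ → ℝ → Em m}

/-- **Iterated leak ratchet, any `ν̂ ≥ 0`.**  With the uniform action bound `M`: if the tail above `n` is `≤ Θ` at all log-times, then the tail
above `n + j` is `≤ (1 − e^{−2C_AΛ⁻¹M})^j·Θ` at all log-times.  MODEL lattice only.
[cite: Tao2016AveragedNS, §4 Lemma 4.1 (4.8)–(4.10), (4.3), viscous equation before Thm. 4.2, §6.4] -/
theorem tail_le_leak_pow_visc (hε : 0 < ε₀) (hc : IsCancellingCoeff α) (hW : IsEternalVisc ε₀ νh α W) (hU : UniformBound W)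
    {M : ℝ} (hM : ∀ k : ℤ, Integrable (fun σ => ‖W k σ‖) ∧ ∫ σ, ‖W k σ‖ ≤ M)
    (n : ℤ) {Θ : ℝ} (hΘ : ∀ σ : ℝ, ∑' k : ℕ, physEnergy ε₀ W (n + k) σ ≤ Θ) (j : ℕ) (σ : ℝ) :
    ∑' k : ℕ, physEnergy ε₀ W (n + j + k) σ ≤ (1 - Real.exp (-(2 * fluxConst α * (bigLam ε₀)⁻¹ * M))) ^ j * Θ := by
  induction j generalizing σ with
  | zero => simpa using hΘ σ
  | succ j ih =>
    have h := tail_succ_le_leak_envelope_visc hε hc hW hU (n + j)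
      (Θ := (1 - Real.exp (-(2 * fluxConst α * (bigLam ε₀)⁻¹ * M))) ^ j * Θ) ih (hM (n + j + 1)).1 (hM (n + j + 1)).2 σ
    have e : (n : ℤ) + ((j + 1 : ℕ) : ℤ) = n + j + 1 := by push_cast; ring
    rw [e, pow_succ]
    linarith

/-- The leak fraction `w = e^{−2C_AΛ⁻¹M}` gives a contraction factor `1 − w ∈ [0, 1)`. -/
theorem leakFactor_bounds (hε : 0 < ε₀) {α : Fin m → Fin m → Fin m → ℤ × ℤ × ℤ → ℝ} {M : ℝ} (hM0 : 0 ≤ M) :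
    0 ≤ 1 - Real.exp (-(2 * fluxConst α * (bigLam ε₀)⁻¹ * M)) ∧
      1 - Real.exp (-(2 * fluxConst α * (bigLam ε₀)⁻¹ * M)) < 1 := by
  have hΛ : 0 < bigLam ε₀ := bigLam_pos (by linarith)
  have := fluxConst_nonneg α
  have hκ : 0 ≤ 2 * fluxConst α * (bigLam ε₀)⁻¹ * M := by positivity
  refine ⟨?_, ?_⟩
  · linarith [Real.exp_le_one_iff.2 (show -(2 * fluxConst α * (bigLam ε₀)⁻¹ * M) ≤ 0 by linarith)]
  · linarith [Real.exp_pos (-(2 * fluxConst α * (bigLam ε₀)⁻¹ * M))]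

/-- **NO CONVEYOR for every covariant viscosity.**  For a uniformly bounded admissible eternal solution (any `ν̂ ≥ 0`, any number of modes) of
a cancelling table with final wakes `ω` and final tails `L` (limits supplied by hypothesis), every final tail equals the sum of the final wakes
above it.  MODEL lattice only.
[cite: Tao2016AveragedNS, §4 Lemma 4.1 (4.8)–(4.10), (4.3), viscous equation before Thm. 4.2, §6.4] -/
theorem noConveyor_all_visc (hε : 0 < ε₀) (hc : IsCancellingCoeff α) (hW : IsEternalVisc ε₀ νh α W) (hU : UniformBound W)
    {ω : ℤ → ℝ} (hω : ∀ k : ℤ, Tendsto (physEnergy ε₀ W k) atTop (𝓝 (ω k)))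
    {L : ℤ → ℝ} (hL : ∀ n : ℤ, Tendsto (fun σ => ∑' k : ℕ, physEnergy ε₀ W (n + k) σ) atTop (𝓝 (L n)))
    (n : ℤ) : L n = ∑' k : ℕ, ω (n + k) := by
  obtain ⟨M, hM⟩ := hW.action
  have hM0 : 0 ≤ M := le_trans (integral_nonneg fun σ => norm_nonneg _) ((hM 0).2)
  have hS : ∀ (n : ℤ) (σ : ℝ), Summable (fun k : ℕ => physEnergy ε₀ W (n + k) σ) :=
    summable_physEnergy_tail_cm hε hU
  obtain ⟨Θ, hΘ⟩ := finalTail_globally_bdd hε hU n (hL n)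
  set q : ℝ := 1 - Real.exp (-(2 * fluxConst α * (bigLam ε₀)⁻¹ * M)) with hq
  obtain ⟨hq0, hq1⟩ := leakFactor_bounds (α := α) hε hM0
  have hm : ∀ j : ℕ, conveyorMass ω L n ≤ q ^ j * Θ := by
    intro j
    have hLj : L (n + j) ≤ q ^ j * Θ :=
      le_of_tendsto' (hL (n + j)) fun σ => tail_le_leak_pow_visc hε hc hW hU hM n hΘ j σ
    have hωj : 0 ≤ ∑' k : ℕ, ω (n + j + k) := tsum_nonneg fun k => finalWake_nonneg hω _
    rw [conveyorMass_const hS hω hL n (n + j)]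
    unfold conveyorMass
    linarith
  have hpow : Tendsto (fun j : ℕ => q ^ j * Θ) atTop (𝓝 (0 * Θ)) :=
    (tendsto_pow_atTop_nhds_zero_of_lt_one hq0 hq1).mul_const Θ
  rw [zero_mul] at hpow
  have hm0 : conveyorMass ω L n ≤ 0 := ge_of_tendsto hpow (Eventually.of_forall hm)
  have hm0' : 0 ≤ conveyorMass ω L n := conveyorMass_nonneg hS hω hL n
  have hmz : conveyorMass ω L n = 0 := le_antisymm hm0 hm0'
  unfold conveyorMass at hmz
  linarith

/-- **Geometric decay of the tail envelopes** (`m = 4`): along every uniformly bounded admissible eternal solution of a cancelling table (any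
`ν̂ ≥ 0`) there is `Θ` with `T_{n+j}(σ) ≤ (1 − e^{−2C_AΛ⁻¹M})^j·Θ` for all `j, σ`.  MODEL lattice only.
[cite: Tao2016AveragedNS, §4 Lemma 4.1 (4.8)–(4.10), (4.3), viscous equation before Thm. 4.2, §6.4] -/
theorem tailEnvelope_decay_visc {α : Fin 4 → Fin 4 → Fin 4 → ℤ × ℤ × ℤ → ℝ} {W : ℤ → ℝ → Em 4}
    (hε : 0 < ε₀) (hc : IsCancellingCoeff α) (hW : IsEternalVisc ε₀ νh α W) (hU : UniformBound W)
    {M : ℝ} (hM : ∀ k : ℤ, Integrable (fun σ => ‖W k σ‖) ∧ ∫ σ, ‖W k σ‖ ≤ M) (n : ℤ) :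
    ∃ Θ : ℝ, ∀ (j : ℕ) (σ : ℝ),
      ∑' k : ℕ, physEnergy ε₀ W (n + j + k) σ ≤ (1 - Real.exp (-(2 * fluxConst α * (bigLam ε₀)⁻¹ * M))) ^ j * Θ := by
  obtain ⟨Θ, hΘ⟩ := wakeRatchet_tailEnvelopeFinite_proof ε₀ νh α W hε hc hW hU n
  exact ⟨Θ, fun j σ => tail_le_leak_pow_visc hε hc hW hU hM n hΘ j σ⟩

/-- **PEAKS FADE for every covariant viscosity** (`m = 4`): for every `δ > 0` some shell's physical energy stays `≤ δ` at all log-times.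
MODEL lattice only.  [cite: Tao2016AveragedNS, §4 Lemma 4.1 (4.8)–(4.10), (4.3), viscous equation before Thm. 4.2, §6.4] -/
theorem peaksFade_all_visc {α : Fin 4 → Fin 4 → Fin 4 → ℤ × ℤ × ℤ → ℝ} {W : ℤ → ℝ → Em 4}
    (hε : 0 < ε₀) (hc : IsCancellingCoeff α) (hW : IsEternalVisc ε₀ νh α W) (hU : UniformBound W)
    {δ : ℝ} (hδ : 0 < δ) : ∃ n : ℤ, ∀ σ : ℝ, physEnergy ε₀ W n σ ≤ δ := by
  obtain ⟨M, hM⟩ := hW.action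
  have hM0 : 0 ≤ M := le_trans (integral_nonneg fun σ => norm_nonneg _) ((hM 0).2)
  obtain ⟨Θ, hΘ⟩ := tailEnvelope_decay_visc hε hc hW hU hM 0
  set q : ℝ := 1 - Real.exp (-(2 * fluxConst α * (bigLam ε₀)⁻¹ * M)) with hq
  obtain ⟨hq0, hq1⟩ := leakFactor_bounds (α := α) hε hM0
  have hpow : Tendsto (fun j : ℕ => q ^ j * Θ) atTop (𝓝 (0 * Θ)) :=
    (tendsto_pow_atTop_nhds_zero_of_lt_one hq0 hq1).mul_const Θ
  rw [zero_mul] at hpow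
  obtain ⟨j, hj⟩ : ∃ j : ℕ, q ^ j * Θ < δ := ((tendsto_order.1 hpow).2 δ hδ).exists
  refine ⟨(0 : ℤ) + j, fun σ => ?_⟩
  have h1 : physEnergy ε₀ W ((0 : ℤ) + j) σ ≤ ∑' k : ℕ, physEnergy ε₀ W ((0 : ℤ) + j + k) σ :=
    WakeRatchetTail.physEnergy_le_tail hε hU _ σ
  have h2 := hΘ j σ
  linarith

end Summit.NavierStokesRegularity.NavierStokesRegularity.Cruxes.EternalViscousRate.DissipationEdge

end
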